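import Literature.NumberTheory.ConnesConsani2024.ProlateWaveMomentsProofs
import Mathlib.MeasureTheory.Measure.CharacteristicFunction.TaylorExpansion
import HarnessLib

/-!
# Connes–Consani–Moscovici 2024, Theorem 5.2 (iii) PROVED: the moments of `(2π)^{−3/2}|Γ(¼ + is/2)|² ds`
# are the Jacobi moments of `a_n = ½√((2n+1)(2n+2))`

LINE 1 — FRAMING: RH-FREE corpus literature (identification of the moments of an explicit probability measure; nothing
here bears on the truth of RH); cell rh-crit, corpus C1, seat t14 (discharge of its own named fact `CCM2024_thm_5_2_iii` of
`ProlateWaveMoments.lean`); bears_on: W-C/W-P (sequel, no leaf role).  WHAT THIS IS NOT: any claim about RH, any new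
named fact (the two `private def`s are honest plumbing: the functions `E_k` and the signed weights `−b_k`).

Source: A. Connes, C. Consani, H. Moscovici, *Zeta zeros and prolate wave operators*, Ann. Funct. Anal. 15 (2024) =
arXiv:2310.18423 [bib: `ConnesConsaniMoscovici2024`], §5.2 Theorem 5.2 (iii) p0018:L71 (proof L89: "The coefficients
`a_n` agree with those given by (fourierfmuall), after rescaling by powers of `i`") and the closing Proposition
«(moments1)» p0018:L121–L148 (held text `paper:arxiv-2310.18423`).

## Route (why this file is separate, and how it deviates from print)

The printed proof of (iii) goes through §3 (Mellin–Plancherel: `𝒰` unitary, `𝒰(h_{2n}) = (−1)ⁿ𝒫_n𝒰(h_0)`, so the `𝒫_n` are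
the orthonormal polynomials of `dm` and its Jacobi matrix is that of `𝕊`, i.e. `a_n`).  The tree has the characteristic
function of `dm` instead — seat t10's `integral_cexp_gammaQuarterMeasure` «(moments1)»: `∫ e^{isx} dm(s) = √(2/(eˣ+e⁻ˣ))`
(`ProlateWaveMomentsProofs.lean`, which imports `ProlateWaveMoments.lean`; hence this third file).  From it the moments are
the derivatives at `0` (Mathlib `iteratedDeriv_charFun_zero`): `iⁿ ∫ sⁿ dm = ((cosh x)^{−1/2})^{(n)}(0)`, and the
identification with the Jacobi moments `c_n = (Aⁿ)_{00} = momentWalk(b) n 0`, `b_k = a_k² = (k+½)(k+1)`, is the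
generating-function identity `(cosh x)^{−1/2} = Σ_m (−1)^m c_{2m} x^{2m}/(2m)!`, proved WITHOUT power series: the functions
`E_k(x) = (cosh x)^{−1/2} tanh(x)^k/k!` satisfy `E_0′ = −b_0E_1`, `E_{k+1}′ = E_k − b_{k+1}E_{k+2}`, `E_k(0) = δ_{k0}` — the
defining recursion of `momentWalk (−b)` — so `E_k^{(n)}(0) = momentWalk (−b) n k` by induction on `n`, and
`momentWalk (−b) (2m) 0 = (−1)^m momentWalk b (2m) 0` (`momentWalk_smul`: each of the `m` up-steps carries one sign).

## What is proved

* `momentWalk_smul` (scaling of Jacobi weights), `integral_pow_gammaQuarterMeasure_eq_metaMoment` (`∫ sⁿ dm = c_n`),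
  `CCM2024_thm_5_2_iii_holds : CCM2024_thm_5_2_iii` (net debt −1).  With `CCM2024_thm_5_2_ii_holds` (determinacy,
  `ProlateWaveMoments.lean`) and seat t10's `CCM2024_prop_moments_sech_holds`, ALL named facts of the §5.2 typing are now
  theorems.
-/

noncomputable section

open Finset Real MeasureTheory ProbabilityTheory Filter Topology
open scoped Nat

namespace Literature.NumberTheory.ConnesConsani2024

section MomentsIdentification

/-! #### (I) `momentWalk` algebra: scaling of the weights and parity -/

/-- `momentWalk b n k = 0` for `n < k` (plumbing; private twin of the lemma in `ProlateWaveMoments.lean`). [folklore] -/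
private theorem momentWalk_eq_zero_of_lt' {R : Type*} [CommSemiring R] (b : ℕ → R) :
    ∀ n k : ℕ, n < k → momentWalk b n k = 0
  | 0, 0, h => absurd h (lt_irrefl 0)
  | 0, _ + 1, _ => by simp [momentWalk]
  | n + 1, 0, h => absurd h (Nat.not_lt_zero _)
  | n + 1, k + 1, h => by
    rw [momentWalk, momentWalk_eq_zero_of_lt' b n k (by omega), momentWalk_eq_zero_of_lt' b n (k + 2) (by omega),
      mul_zero, add_zero]

/-- Parity (plumbing; private twin of the lemma in `ProlateWaveMoments.lean`): `momentWalk b n k = 0` when `n + k` is odd. [folklore] -/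
private theorem momentWalk_eq_zero_of_odd' {R : Type*} [CommSemiring R] (b : ℕ → R) :
    ∀ n k : ℕ, Odd (n + k) → momentWalk b n k = 0
  | 0, 0, h => by simp at h
  | 0, _ + 1, _ => by simp [momentWalk]
  | n + 1, 0, h => by
    rw [momentWalk, momentWalk_eq_zero_of_odd' b n 1 (by simpa using h), mul_zero]
  | n + 1, k + 1, h => by
    obtain ⟨m, hm⟩ := h
    rw [momentWalk, momentWalk_eq_zero_of_odd' b n k ⟨m - 1, by omega⟩,
      momentWalk_eq_zero_of_odd' b n (k + 2) ⟨m, by omega⟩, mul_zero, add_zero]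

/-- Scaling the Jacobi weights `b ↦ c·b` multiplies every lattice path from level `k` to `0` with `u` up-steps by `c^u`:
`momentWalk (c·b) (k+2u) k = c^u · momentWalk b (k+2u) k` (so `c_{2m}(−b) = (−1)^m c_{2m}(b)`: the substitution `x ↦ ix`). [cite: ConnesConsaniMoscovici2024, §5.2 eq. (Szego) p0017:L81–L87; §2.2 p0007:L84–L97] -/
theorem momentWalk_smul {R : Type*} [CommRing R] (c : R) (b : ℕ → R) :
    ∀ n u k : ℕ, k + 2 * u = n → momentWalk (fun j => c * b j) n k = c ^ u * momentWalk b n k := by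
  intro n
  induction n using Nat.strong_induction_on with
  | _ n ih =>
    intro u k hn
    rcases n with _ | n
    · have hu : u = 0 := by omega
      have hk : k = 0 := by omega
      subst hu; subst hk; simp [momentWalk]
    rcases k with _ | k
    · rcases u with _ | u
      · omega
      rw [momentWalk, momentWalk, ih n (by omega) u 1 (by omega), pow_succ]; ring
    · rw [momentWalk, momentWalk, ih n (by omega) u k (by omega)]
      rcases u with _ | u
      · rw [momentWalk_eq_zero_of_lt' _ n (k + 2) (by omega), momentWalk_eq_zero_of_lt' _ n (k + 2) (by omega)]
        ring
      · rw [ih n (by omega) u (k + 2) (by omega), pow_succ]; ring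

/-! #### (II) The smooth functions `E_k(x) = (cosh x)^{−1/2} tanh(x)^k / k!` and their derivatives -/

/-- The Jacobi weights `b_k = a_k² = ¼(2k+1)(2k+2) = (k+½)(k+1)` over `ℝ` (plumbing). [folklore] -/
private theorem bWeight_def (k : ℕ) : ((2 * (k : ℝ) + 1) * (2 * k + 2) / 4 : ℝ) = ((k : ℝ) + 1 / 2) * (k + 1) := by ring

/-- RH-FREE (plumbing). `E_k(x) := (cosh x)^{−1/2} tanh(x)^k / k!` — the column generating functions of the signed path
counts: `E_k^{(n)}(0) = momentWalk (−b) n k` (`iteratedDeriv_eFun_zero`); `E_0 = (cosh x)^{−1/2} = √(2/(eˣ+e⁻ˣ))` is the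
characteristic function of `dm` «(moments1)». [cite: ConnesConsaniMoscovici2024, Thm 5.2 (iii) p0018:L71, proof p0018:L89; Prop. (moments1) p0018:L121–L148] -/
private def eFun (k : ℕ) (x : ℝ) : ℝ :=
  Real.cosh x ^ (-(1 / 2 : ℝ)) * (Real.sinh x / Real.cosh x) ^ k / (k ! : ℝ)

/-- `((cosh x)^{−1/2})′ = −½ tanh x (cosh x)^{−1/2}` (plumbing). [folklore] -/
private theorem hasDerivAt_rpow_cosh (x : ℝ) :
    HasDerivAt (fun y => Real.cosh y ^ (-(1 / 2 : ℝ)))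
      (-(1 / 2 : ℝ) * (Real.sinh x / Real.cosh x) * Real.cosh x ^ (-(1 / 2 : ℝ))) x := by
  have hc := Real.cosh_pos x
  have h := (Real.hasDerivAt_cosh x).rpow_const (p := -(1 / 2 : ℝ)) (Or.inl hc.ne')
  refine h.congr_deriv ?_
  rw [show (-(1 / 2 : ℝ)) - 1 = -(1 / 2 : ℝ) + (-1) by norm_num, Real.rpow_add hc, Real.rpow_neg_one, div_eq_mul_inv]
  ring

/-- `(sinh/cosh)′ = 1 − (sinh/cosh)²` (plumbing). [folklore] -/
private theorem hasDerivAt_tanh' (x : ℝ) :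
    HasDerivAt (fun y => Real.sinh y / Real.cosh y) (1 - (Real.sinh x / Real.cosh x) ^ 2) x := by
  have hc := Real.cosh_pos x
  have h := (Real.hasDerivAt_sinh x).div (Real.hasDerivAt_cosh x) hc.ne'
  refine h.congr_deriv ?_
  rw [div_pow, sub_div, ← pow_two, ← pow_two, div_self (pow_ne_zero 2 hc.ne')]

/-- `E_0′ = −b_0 E_1` (`b_0 = ½`; plumbing). [folklore] -/
private theorem hasDerivAt_eFun_zero (x : ℝ) :
    HasDerivAt (eFun 0) (-(1 / 2 : ℝ) * eFun 1 x) x := by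
  have h := hasDerivAt_rpow_cosh x
  have e : eFun 0 = fun y => Real.cosh y ^ (-(1 / 2 : ℝ)) := by
    funext y; simp [eFun]
  rw [e]
  refine h.congr_deriv ?_
  simp only [eFun, pow_one, Nat.factorial_one, Nat.cast_one, div_one]
  ring

/-- `E_{k+1}′ = E_k − b_{k+1} E_{k+2}`, `b_{k+1} = (k+3/2)(k+2)` — the column recursion of `momentWalk` with the weights
`−b` (plumbing). [folklore] -/
private theorem hasDerivAt_eFun_succ (k : ℕ) (x : ℝ) :
    HasDerivAt (eFun (k + 1)) (eFun k x - (((k : ℝ) + 1 + 1 / 2) * ((k : ℝ) + 1 + 1)) * eFun (k + 2) x) x := by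
  have hf := hasDerivAt_rpow_cosh x
  have hu := hasDerivAt_tanh' x
  have h := ((hf.mul (hu.pow (k + 1))).div_const (((k + 1)! : ℕ) : ℝ))
  have e : eFun (k + 1) = fun y => Real.cosh y ^ (-(1 / 2 : ℝ)) * (Real.sinh y / Real.cosh y) ^ (k + 1) / (((k + 1)! : ℕ) : ℝ) := by
    funext y; simp [eFun]
  rw [e]
  refine h.congr_deriv ?_
  simp only [eFun, Nat.factorial_succ, Nat.cast_mul, Nat.cast_add, Nat.cast_one, pow_succ, Nat.add_succ_sub_one,
    Pi.pow_apply]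
  have hk : ((k ! : ℕ) : ℝ) ≠ 0 := by positivity
  have hk1 : ((k : ℝ) + 1) ≠ 0 := by positivity
  have hk2 : ((k : ℝ) + 1 + 1) ≠ 0 := by positivity
  field_simp
  ring

/-! #### (III) Smoothness and iterated derivatives at `0` -/

/-- `E_k` is smooth (plumbing). [folklore] -/
private theorem contDiff_eFun (k : ℕ) {n : ℕ} : ContDiff ℝ n (eFun k) := by
  have hc : ContDiff ℝ n Real.cosh := Real.contDiff_cosh
  have hs : ContDiff ℝ n Real.sinh := Real.contDiff_sinh
  have hne : ∀ x, Real.cosh x ≠ 0 := fun x => (Real.cosh_pos x).ne'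
  unfold eFun
  exact ((hc.rpow_const_of_ne hne).mul ((hs.div hc hne).pow k)).div_const _

/-- `deriv E_0 = −½ E_1` (plumbing). [folklore] -/
private theorem deriv_eFun_zero : deriv (eFun 0) = fun x => -(1 / 2 : ℝ) * eFun 1 x :=
  funext fun x => (hasDerivAt_eFun_zero x).deriv

/-- `deriv E_{k+1} = E_k − b_{k+1}E_{k+2}` (plumbing). [folklore] -/
private theorem deriv_eFun_succ (k : ℕ) :
    deriv (eFun (k + 1)) = fun x => eFun k x - (((k : ℝ) + 1 + 1 / 2) * ((k : ℝ) + 1 + 1)) * eFun (k + 2) x :=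
  funext fun x => (hasDerivAt_eFun_succ k x).deriv

/-- RH-FREE (plumbing). The negated Jacobi weights `−b_k = −¼(2k+1)(2k+2)` (the sign records `x ↦ ix`: `cosh x = cos(ix)`).
[cite: ConnesConsaniMoscovici2024, §5.2 eq. (Szego) p0017:L81–L87; §2.2 p0007:L84–L97] -/
private def negWeight (k : ℕ) : ℝ := -(((k : ℝ) + 1 / 2) * ((k : ℝ) + 1))

/-- `E_k^{(n)}(0) = momentWalk (−b) n k`: the Taylor coefficients of `(cosh x)^{−1/2} tanh(x)^k/k!` at `0` are the signed
weighted lattice-path counts — both arrays satisfy the same recursion in `n` with the same initial data (plumbing). [folklore] -/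
private theorem iteratedDeriv_eFun_zero : ∀ n k : ℕ, iteratedDeriv n (eFun k) 0 = momentWalk negWeight n k := by
  intro n
  induction n with
  | zero =>
    intro k
    rcases k with _ | k
    · simp [eFun, momentWalk]
    · simp [eFun, momentWalk]
  | succ n ih =>
    intro k
    rcases k with _ | k
    · rw [iteratedDeriv_succ', deriv_eFun_zero, iteratedDeriv_const_mul_field, ih 1, momentWalk, negWeight]
      norm_num
    · rw [iteratedDeriv_succ', deriv_eFun_succ,
        iteratedDeriv_fun_sub (contDiff_eFun k).contDiffAt (contDiff_const.mul (contDiff_eFun (k + 2))).contDiffAt,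
        iteratedDeriv_const_mul_field, ih k, ih (k + 2), momentWalk, negWeight]
      push_cast; ring

/-! #### (IV) The characteristic function of `dm` is `E_0 = (cosh x)^{−1/2}` (seat t10's theorem) -/

/-- `√(2/(eˣ+e⁻ˣ)) = (cosh x)^{−1/2}` (plumbing). [folklore] -/
private theorem sqrt_two_div_eq (x : ℝ) :
    Real.sqrt (2 / (Real.exp x + Real.exp (-x))) = Real.cosh x ^ (-(1 / 2 : ℝ)) := by
  have hc := Real.cosh_pos x
  rw [show (2 : ℝ) / (Real.exp x + Real.exp (-x)) = (Real.cosh x)⁻¹ by rw [Real.cosh_eq]; field_simp,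
    Real.sqrt_inv, Real.sqrt_eq_rpow, Real.rpow_neg hc.le]

/-- The characteristic function of `dm` is `E_0 = (cosh x)^{−1/2}` — seat t10's `integral_cexp_gammaQuarterMeasure`
«(moments1)» in Mathlib's `charFun` spelling (plumbing). [cite: ConnesConsaniMoscovici2024, Thm 5.2 (iii) p0018:L71, proof p0018:L89; Prop. (moments1) p0018:L121–L148] -/
private theorem charFun_gammaQuarterMeasure :
    charFun gammaQuarterMeasure = fun x : ℝ => ((eFun 0 x : ℝ) : ℂ) := by
  funext x
  rw [charFun_apply_real]
  have h := integral_cexp_gammaQuarterMeasure x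
  have e : (fun s : ℝ => Complex.exp (x * s * Complex.I)) = fun s : ℝ => Complex.exp (Complex.I * s * x) := by
    funext s; ring_nf
  rw [e, h, sqrt_two_div_eq]
  simp [eFun]

/-! #### (V) Iterated derivatives commute with `ℝ → ℂ` -/

/-- Iterated derivatives commute with the inclusion `ℝ → ℂ` for smooth functions (plumbing). [folklore] -/
private theorem iteratedDeriv_ofReal_comp :
    ∀ (n : ℕ) (g : ℝ → ℝ), (∀ m : ℕ, ContDiff ℝ m g) →
      iteratedDeriv n (fun x => ((g x : ℝ) : ℂ)) = fun x => ((iteratedDeriv n g x : ℝ) : ℂ) := by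
  intro n
  induction n with
  | zero => intro g _; simp
  | succ n ih =>
    intro g hg
    have hd : Differentiable ℝ g := (hg 1).differentiable (by norm_num)
    have hderiv : deriv (fun x => ((g x : ℝ) : ℂ)) = fun x => ((deriv g x : ℝ) : ℂ) := by
      funext x; exact ((hd x).hasDerivAt.ofReal_comp).deriv
    have hg' : ∀ m : ℕ, ContDiff ℝ m (deriv g) := fun m =>
      (contDiff_succ_iff_deriv.mp (hg (m + 1))).2.2
    rw [iteratedDeriv_succ', hderiv, ih (deriv g) hg', ← iteratedDeriv_succ']

/-! #### (VI) Moments of `dm` from the characteristic function -/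

/-- `id ∈ Lⁿ(dm)` (all moments exist — seat t10's `integrable_pow_gammaQuarterMeasure`; plumbing). [cite: ConnesConsaniMoscovici2024, Thm 5.2 (iii) p0018:L71, proof p0018:L89; Prop. (moments1) p0018:L121–L148] -/
private theorem memLp_id_gammaQuarterMeasure (n : ℕ) : MemLp id (n : ENNReal) gammaQuarterMeasure := by
  rcases Nat.eq_zero_or_pos n with rfl | hn
  · simp only [Nat.cast_zero, memLp_zero_iff_aestronglyMeasurable]
    exact aestronglyMeasurable_id
  · rw [← integrable_norm_rpow_iff aestronglyMeasurable_id (by exact_mod_cast hn.ne') (ENNReal.natCast_ne_top n)]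
    have h := (integrable_pow_gammaQuarterMeasure n).abs
    refine h.congr (Filter.Eventually.of_forall fun x => ?_)
    simp [abs_pow, Real.rpow_natCast]

/-- `iⁿ ∫ sⁿ dm = momentWalk (−b) n 0`: the moments of `dm` are read off the derivatives at `0` of its characteristic
function (Mathlib `iteratedDeriv_charFun_zero`), i.e. of `E_0` (plumbing). [cite: ConnesConsaniMoscovici2024, Thm 5.2 (iii) p0018:L71, proof p0018:L89; Prop. (moments1) p0018:L121–L148] -/
private theorem I_pow_mul_integral_pow (n : ℕ) :
    Complex.I ^ n * ((∫ s : ℝ, s ^ n ∂gammaQuarterMeasure : ℝ) : ℂ) = ((momentWalk negWeight n 0 : ℝ) : ℂ) := by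
  haveI := isProbabilityMeasure_gammaQuarterMeasure
  have h := iteratedDeriv_charFun_zero (μ := gammaQuarterMeasure) (memLp_id_gammaQuarterMeasure n)
  rw [charFun_gammaQuarterMeasure, iteratedDeriv_ofReal_comp n (eFun 0) (fun m => contDiff_eFun 0)] at h
  simp only at h
  rw [iteratedDeriv_eFun_zero] at h
  rw [← h]

/-- **The moments of `dm = (2π)^{−3/2}|Γ(¼+is/2)|²ds` are the Jacobi moments `c_n` of `a_n = ½√((2n+1)(2n+2))`**
("The coefficients `a_n` agree with those given by (fourierfmuall)", proof of Thm 5.2 (iii) p0018:L89): PROVED here from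
the characteristic function «(moments1)» (seat t10) by the generating-function identity
`(cosh x)^{−1/2} = Σ_m (−1)^m c_{2m} x^{2m}/(2m)!`, itself proved through the column system `E_k′ = E_{k−1} − b_kE_{k+1}`.
[cite: ConnesConsaniMoscovici2024, Thm 5.2 (iii) p0018:L71, proof p0018:L89; Prop. (moments1) p0018:L121–L148] -/
theorem integral_pow_gammaQuarterMeasure_eq_metaMoment (n : ℕ) :
    ∫ s : ℝ, ((s : ℂ) ^ n) ∂gammaQuarterMeasure = metaMoment n := by
  have hc : ∫ s : ℝ, ((s : ℂ) ^ n) ∂gammaQuarterMeasure = ((∫ s : ℝ, s ^ n ∂gammaQuarterMeasure : ℝ) : ℂ) := by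
    simp_rw [← Complex.ofReal_pow]; exact integral_ofReal
  rw [hc]
  have h := I_pow_mul_integral_pow n
  rcases Nat.even_or_odd n with ⟨m, rfl⟩ | hodd
  · -- even: `i^{2m} = (−1)^m` and `momentWalk (−b) (2m) 0 = (−1)^m c_{2m}`
    have hneg : negWeight = fun j : ℕ => (-1 : ℝ) * ((2 * (j : ℝ) + 1) * (2 * (j : ℝ) + 2) / 4) := by
      funext j; simp only [negWeight]; ring
    rw [hneg, show m + m = 0 + 2 * m by ring, momentWalk_smul (-1 : ℝ) _ (0 + 2 * m) m 0 rfl,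
      show 0 + 2 * m = 2 * m by ring, ← metaMomentQ_cast, pow_mul, Complex.I_sq] at h
    rw [show m + m = 2 * m by ring, metaMoment_eq_cast]
    have h1 : ((-1 : ℂ) ^ m) ≠ 0 := pow_ne_zero _ (by norm_num)
    apply mul_left_cancel₀ h1
    rw [h]; push_cast; ring
  · -- odd: both sides vanish
    rw [momentWalk_eq_zero_of_odd' negWeight n 0 (by simpa using hodd)] at h
    have hI : Complex.I ^ n ≠ 0 := pow_ne_zero _ Complex.I_ne_zero
    have h0 : ((∫ s : ℝ, s ^ n ∂gammaQuarterMeasure : ℝ) : ℂ) = 0 := by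
      rcases mul_eq_zero.mp (by rw [h]; simp) with h' | h'
      · exact absurd h' hI
      · exact h'
    rw [h0, metaMoment, jacobiMoment_eq_zero_of_odd _ hodd]

/-- **Discharge of the named fact `CCM2024_thm_5_2_iii`** — Theorem 5.2 (iii): "The unique measure `dμ` of the moment
problem of (ii) is the probability measure proportional to `|Γ(¼ + ½is)|² ds`": `dm` is a probability measure (seat t10,
`isProbabilityMeasure_gammaQuarterMeasure`), all its moments exist (seat t10) and they are the `c_n`
(`integral_pow_gammaQuarterMeasure_eq_metaMoment`); uniqueness is `CCM2024_thm_5_2_ii_holds` (`ProlateWaveMoments.lean`).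
[cite: ConnesConsaniMoscovici2024, Thm 5.2 (iii) p0018:L71, proof p0018:L89; Prop. (moments1) p0018:L121–L148] -/
theorem CCM2024_thm_5_2_iii_holds : CCM2024_thm_5_2_iii :=
  ⟨isProbabilityMeasure_gammaQuarterMeasure, fun n =>
    ⟨integrable_pow_gammaQuarterMeasure n, integral_pow_gammaQuarterMeasure_eq_metaMoment n⟩⟩

end MomentsIdentification

end Literature.NumberTheory.ConnesConsani2024
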